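import Literature.Analysis.FluidPDE.Tao2016AveragedNS.SplitCascadeReduction
import Literature.Analysis.FluidPDE.Tao2016AveragedNS.LocalCascadeSolutions
import HarnessLib

/-!
# Renormalised cascade waves: discretely self-similar (DSS) blow-up profiles, eternal solutions and the viscous lattice for Tao-type cascade tables

Source: T. Tao, *Finite time blowup for an averaged three-dimensional Navier–Stokes equation*,
J. Amer. Math. Soc. 29 (2016), arXiv:1402.0290 — §4 (the cascade ODE (4.5)–(4.11) for general
structure constants `α`), §5–§6 (the renormalised, self-similar description of the blow-up).  This
module adds, on top of `SplitCascadeReduction` (tables `α`, `shiftSet`, `IsSymmetricCoeff`,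
`IsCancellingCoeff`, `CascadeODESolutionFrom`) and `LocalCascadeSolutions` (`InTableClass`,
`NoGlobalCascade`), the OBJECT vocabulary of the self-similar analysis of such lattice ODEs:

* abstract profile systems on a finite index set with a shape permutation (`IsSWave`, `IsTW`,
  `STable`, summed energy / mass / flux `sEnergy`, `sMass`, `sFlux`);
* the dictionary table ↦ shell-vector structure maps (`Em`, `qform`, `tableQ`, `tableA`, `tableB`,
  `fluxConst`);
* admissible discretely-self-similar blow-up waves of a table at scale ratio `1+ε₀` (`bigLam`,
  `dssMu`, `wEnergy`, `IsDSSWave`, `dssAction`) and the survival predicate `Surviving a ε₀ T`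
  (per-shell energy ratio `μ` with `(1+ε₀)^{-a} ≤ μ < 1`);
* eternal solutions of the renormalised lattice (`shellVec`, `IsEternal`, `physWeight`, `dssEmbed`,
  `physEnergy`, `physFlux`, `EternalSurvivingFwd`);
* global pseudo-solutions, shell shifts and the NS-scaled viscous lattice (`HasGlobal`, `shellShift`,
  `ViscousGlobal`), and the scalar dyadic member `dyadicTable` of the comparable class (the
  Katz–Pavlović / Cheskidov chain written as an `m = 4` table).

PLACEMENT OF THE PRINTED EXACT SOLUTION (cell referee c17): the separable finite-time blow-up of
the inviscid scalar dyadic chain (Barbato–Flandoli–Morandin 2011, arXiv:0811.1689 p. 3, by time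
inversion of their positive self-similar solutions; every base `λ > 1`) is a fixed point of the
renormalised dynamics and is EXCLUDED by the DSS structure and by the admissibility clauses `mass` /
`bdd` of `IsDSSWave` (resp. the action bound of `IsEternal`) — see those docstrings; the waves of
this file describe FRONT-type blow-up (energy passing shell after shell with a log-time delay), the
blow-up mode of Tao's Theorem 4.2 from one-shell data.

DEFINITIONS ONLY (no claims), plus three unfolding / positivity lemmas (`bigLam_pos`, `dssMu_pos`,
`shellVec_apply`).  Every declaration is a statement ABOUT MODEL LATTICE ODEs; nothing in
this file is a statement about the Navier–Stokes equations.  Provenance: the text is the definitional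
part of the kernel-checked cell file `harvest-h2-tao-ladder-theory-2/ThmAB_general_v12.lean`
(sha16 0213002eed391f21, Parts 2, 5, 7, 8, 9, 11; authored by the cell's theory-2 seats), re-based
verbatim onto the tree declarations `TaoCascade.InTableClass` / `NoGlobalCascade` /
`CascadeODESolutionFrom`; conjecture-level propositions of that file (K1/K2, UVS, …) are NOT
included — they are route items (rule 4b).  Landed for the definition request `defn-IsDSSWave`
(planner harvest-h2-tao-ladder theory-1 g6; evidence file sha16 2cc33ede97751103, declarations
verbatim); this is the THIRD module of that lattice vocabulary after `LocalCascadeSolutions` and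
`RestartedCascadeFlows`.  TAGS: every declaration cites the display of [`Tao2016AveragedNS`]
(arXiv:1402.0290v3) it is modelled on — §4 (4.1)–(4.3) (cascade operator, structure constants on
`S`, symmetry, cancellation), Lemma 4.1 (4.5)–(4.11), the viscous equation and the Katz–Pavlović
remark before Theorem 4.2, §1.2 (dyadic model, energy transfer) — and is marked «cell vocabulary»
where the object (profile systems, DSS / eternal solutions, survival predicates) is the cell's own
and does not occur in the paper.
-/

noncomputable section

open Filter Topology intervalIntegral Set MeasureTheory
open scoped RealInnerProductSpace

namespace Literature.Analysis.FluidPDE.TaoCascade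

open Literature.Analysis.FluidPDE

section AbstractS

variable {V : Type*} [NormedAddCommGroup V]
variable {ρ : Type*} [Fintype ρ]

/-- Summed profile energy `Σ_r ‖Φ_r x‖²`.
[cite: Tao2016AveragedNS, §4 Lemma 4.1 (4.9)–(4.10) (local energies `E_{i,n} ≈ ½X_{i,n}²`, summed over a profile family); cell vocabulary] -/
def sEnergy (Φ : ρ → ℝ → V) (x : ℝ) : ℝ := ∑ r, ‖Φ r x‖ ^ 2

/-- Summed profile mass `Σ_r ‖Φ_r x‖` (the `g` of the scalar cores).
[cite: Tao2016AveragedNS, §4 Lemma 4.1 (4.8) (mode amplitudes `X_{i,n}`; summed norm of a profile family); cell vocabulary] -/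
def sMass (Φ : ρ → ℝ → V) (x : ℝ) : ℝ := ∑ r, ‖Φ r x‖

variable [InnerProductSpace ℝ V]

/-- Structure maps of a local cascade table on Tao's shift set `S`, grouped by monomial type
(module docstring).  `B` (back-reaction from the shell above) is constrained ONLY through the
cancellation identity; `normA` is where the topology enters (outflow quadratic in the emitting
shell).
[cite: Tao2016AveragedNS, §4 (4.1)–(4.3) (structure constants on the shift set `S`, symmetry, cancellation) and Lemma 4.1 (4.8); cell vocabulary (the constraints grouped by monomial type)] -/
structure STable (Q A : V → V) (B : V → V → V) (CA : ℝ) : Prop where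
  intra : ∀ x, ⟪x, Q x⟫ = 0
  cancel : ∀ x y, ⟪y, A x⟫ + ⟪x, B y x⟫ = 0
  normA : ∀ x, ‖A x‖ ≤ CA * ‖x‖ ^ 2
  CA_nonneg : 0 ≤ CA
  contA : Continuous A

/-- A finite family of profiles `Φ r` (shell `n` carries `Φ r`, shell `n+1` carries `Φ (π r)`,
shell `n-1` carries `Φ (π⁻¹ r)`, consecutive shells delayed by `T`) solving the profile system
with damping `d`, feed coefficient `c₁` (from the shell behind, phase `x + T`) and drain
coefficient `c₂` (to the shell ahead, phase `x - T`).  `(d, c₁, c₂) = (0, 1, 1)`: travelling /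
period-`q` wave of the uniform `λ = 1` lattice; `(1, λ^{5/2}, λ^{-5/2})`: discretely
self-similar cascade of the `λ`-lattice in renormalised variables.
[cite: Tao2016AveragedNS, §4 Lemma 4.1 (iii) (4.8) (equation of motion, gain `(1+ε₀)^{5(n-μ₃)/2}`, shifts `μ ∈ S`); cell vocabulary (profile ansatz `X_n(t) ↔ Φ_{r(n)}(· - nT)`)] -/
def IsSWave (π : Equiv.Perm ρ) (Q A : V → V) (B : V → V → V) (d c₁ c₂ T : ℝ)
    (Φ : ρ → ℝ → V) : Prop :=
  ∀ r x, HasDerivAt (Φ r)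
    (-(d • Φ r x) + Q (Φ r x) + c₁ • A (Φ (π.symm r) (x + T))
      + c₂ • B (Φ (π r) (x - T)) (Φ r x)) x

/-- Summed outflow at phase `σ`: what the shells at phase `σ` feed to the shells ahead of them
(which are at phase `σ - T`).
[cite: Tao2016AveragedNS, §1.2 (energy transfer equations: flow of energy at rate `λ^n X_{n+1} X_n²` from mode `n` to mode `n+1`) and §4 Lemma 4.1 (4.9); cell vocabulary] -/
def sFlux (π : Equiv.Perm ρ) (A : V → V) (T : ℝ) (Φ : ρ → ℝ → V) (σ : ℝ) : ℝ :=
  ∑ r, ⟪Φ (π r) (σ - T), A (Φ r σ)⟫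

/-- A single profile `Φ` with `X_n(t) = Φ(t - nT)`: the travelling-wave profile equation
`Φ' = -dΦ + Q Φ + c₁ A(Φ(·+T)) + c₂ B(Φ(·-T), Φ)`.
[cite: Tao2016AveragedNS, §4 Lemma 4.1 (iii) (4.8); cell vocabulary (single-profile travelling-wave ansatz)] -/
def IsTW (Q A : V → V) (B : V → V → V) (d c₁ c₂ T : ℝ) (Φ : ℝ → V) : Prop :=
  ∀ x, HasDerivAt Φ
    (-(d • Φ x) + Q (Φ x) + c₁ • A (Φ (x + T)) + c₂ • B (Φ (x - T)) (Φ x)) x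

end AbstractS

section TableDictionary

variable {m : ℕ}

/-- `ℝ^m` with its Euclidean structure (mode amplitudes of one shell).
[cite: Tao2016AveragedNS, §4 Lemma 4.1 (the amplitudes `X_{i,n}`, `i = 1, …, m`, of one shell); cell vocabulary] -/
abbrev Em (m : ℕ) := EuclideanSpace ℝ (Fin m)

/-- The bilinear coordinate form `Σ_{i₁ i₂} α_{i₁ i₂ i, μ} y_{i₁} x_{i₂}` of a table `α` at shift `μ`.
[cite: Tao2016AveragedNS, §4 (4.1) and Lemma 4.1 (4.8) (the bilinear forms `Σ_{i₁,i₂} α_{i₁ i₂ i, μ} X_{i₁,·} X_{i₂,·}`)] -/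
def qform (α : Fin m → Fin m → Fin m → ℤ × ℤ × ℤ → ℝ) (μ : ℤ × ℤ × ℤ) (y x : Em m)
    (i : Fin m) : ℝ :=
  ∑ i₁, ∑ i₂, α i₁ i₂ i μ * (y i₁ * x i₂)

/-- Intra-shell field of the table: the `μ = (0,0,0)` monomials.
[cite: Tao2016AveragedNS, §4 Lemma 4.1 (4.8) with `S = {(0,0,0),(1,0,0),(0,1,0),(0,0,1)}` ((4.1)); cell vocabulary (the `μ = (0,0,0)` group)] -/
def tableQ (α : Fin m → Fin m → Fin m → ℤ × ℤ × ℤ → ℝ) (x : Em m) : Em m :=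
  ∑ i, qform α (0, 0, 0) x x i • EuclideanSpace.single i (1 : ℝ)

/-- Outflow of the table: the `μ = (0,0,1)` monomials (what a shell holding `x` feeds the shell
above; in `quadTerm` they come with the gain `(1+ε₀)^{5(n-1)/2}` of the emitting shell).
[cite: Tao2016AveragedNS, §4 Lemma 4.1 (4.8) with `S` as in (4.1); cell vocabulary (the `μ = (0,0,1)` group)] -/
def tableA (α : Fin m → Fin m → Fin m → ℤ × ℤ × ℤ → ℝ) (x : Em m) : Em m :=
  ∑ i, qform α (0, 0, 1) x x i • EuclideanSpace.single i (1 : ℝ)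

/-- Back-reaction of the table: the `μ = (1,0,0)` monomials `y_{i₁} x_{i₂}` and the `μ = (0,1,0)`
monomials `x_{i₁} y_{i₂}` (shell holding `x`, shell above holding `y`).
[cite: Tao2016AveragedNS, §4 Lemma 4.1 (4.8) with `S` as in (4.1); cell vocabulary (the `μ = (1,0,0)`, `(0,1,0)` groups)] -/
def tableB (α : Fin m → Fin m → Fin m → ℤ × ℤ × ℤ → ℝ) (y x : Em m) : Em m :=
  ∑ i, (qform α (1, 0, 0) y x i + qform α (0, 1, 0) x y i) • EuclideanSpace.single i (1 : ℝ)

/-- The flux constant `C_A(α) := Σ_{i i₁ i₂} |α_{i₁ i₂ i,(0,0,1)}|` (`≤ m³` on every comparable table).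
[cite: Tao2016AveragedNS, §4 (4.1) (structure constants at shift `(0,0,1)`); cell vocabulary] -/
def fluxConst (α : Fin m → Fin m → Fin m → ℤ × ℤ × ℤ → ℝ) : ℝ :=
  ∑ i, ∑ i₁, ∑ i₂, |α i₁ i₂ i (0, 0, 1)|

end TableDictionary

section DSSWaves

variable {ρ : Type*} [Fintype ρ]
variable {m : ℕ}

/-- `Λ = λ^{5/2} = (1+ε₀)^{5/2}`: the per-shell gain of the `λ`-lattice in the normal form
`Ẋ_n = Λ^n [Q(X_n) + B(X_{n+1}, X_n)] + Λ^{n-1} A(X_{n-1})`.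
[cite: Tao2016AveragedNS, §4 (4.1) (the weight `(1+ε₀)^{5n/2}`) and the remark before Thm. 4.2 («`λ = (1+ε₀)^{5/2}`»)] -/
def bigLam (ε₀ : ℝ) : ℝ := (1 + ε₀) ^ ((5 : ℝ) / 2)

/-- Per-shell ENERGY RATIO of a DSS wave with delay `T`: `μ = e^{2T} Λ^{-2} = e^{2T}/(1+ε₀)^5`
(shell `n+1` repeats shell `n`'s renormalised history `T` later in `s = -log(t* - t)`, at scale
weight `Λ^{-2}`).
[cite: Tao2016AveragedNS, §4 Lemma 4.1 (4.8)–(4.9) read in self-similar variables `s = -log(t_* - t)`; cell vocabulary] -/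
def dssMu (ε₀ T : ℝ) : ℝ := Real.exp (2 * T) / (1 + ε₀) ^ 5

/-- Renormalised summed energy `ẽ(x) = e^{2dx} Σ_r ‖Φ_r x‖²`.
[cite: Tao2016AveragedNS, §4 Lemma 4.1 (4.9)–(4.10) (local energies) in self-similar variables; cell vocabulary] -/
def wEnergy {V : Type*} [NormedAddCommGroup V] (d : ℝ) (Φ : ρ → ℝ → V) (x : ℝ) : ℝ :=
  Real.exp (2 * d * x) * sEnergy Φ x

/-- **Admissible discretely-self-similar (DSS) blow-up wave** of the table `α` at scale ratio
`1+ε₀`, with profile family `Φ : ρ → ℝ → ℝ^m`, shape permutation `π` and delay `T > 0`: the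
abstract profile system `IsSWave` in renormalised variables (`d = 1`, feed `c₁ = Λ`, drain `c₂ = Λ⁻¹`) for
the table's structure maps, plus the admissibility hypotheses (a) integrable summed mass
and (b) renormalised energy bounded on a right half-line.  (In original variables:
`X_n(t) = Λ^{-n} e^{s} Φ_{r(n)}(s - nT)`, `s = -log(t* - t)`.)  MODEL object of a lattice ODE.

PLACEMENT of the printed exact blow-up (Barbato–Flandoli–Morandin, TAMS 2011, arXiv:0811.1689
p. 3: the separable solutions `X_n(t) = a_n/(t - t₀)`, `(a_n) ∈ l²`, `a_n ≍ Λ^{-n/3} = λ^{-5n/6}`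
(base = the coefficient ratio `Λ = (1+ε₀)^{5/2}`; BFM print `a_n ∼ C·2^{-n/3}` for `k_n = 2^n`), obtained from
the positive self-similar decaying solutions by time inversion — all components negative, every
component blowing up at the SAME instant `t₀`; any base `λ > 1`).  Such a solution is a FIXED POINT
of the renormalised dynamics, not a wave: in the variables above it reads `Φ_{r(n)}(s - nT) = Λ^{n} a_n`
for all `s`, i.e. `x`-CONSTANT profiles whose amplitudes `Λ^n a_n ≍ Λ^{2n/3} = λ^{5n/3}` are unbounded in `n`.
It is therefore NOT an `IsDSSWave` for three independent reasons: (i) no finite profile family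
`ρ` with a shape permutation `π` reproduces an amplitude pattern unbounded in `n` (the DSS
structure itself fails); (ii) `mass` fails (a non-zero constant summed mass is not integrable on
`ℝ`); (iii) `bdd` fails (`e^{2x} Σ_r ‖Φ_r x‖² → ∞`).  `delay_pos` is NOT the excluding clause
(constants are shift-invariant).  Clauses (ii)/(iii) say "the energy ARRIVES at and LEAVES every
shell in log-time" — front-type blow-up, shell after shell with delay `T` — as opposed to
simultaneous separable blow-up; they are LOAD-BEARING for every statement quantifying over
`IsDSSWave` (a "no surviving DSS wave" claim says nothing about separable blow-up), and the same
solution is excluded from `IsEternal` below by its log-time action bound.  (From ONE-SHELL data —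
the data of `NoGlobalCascade` — the scalar chain feeds shell `n+1` through `X_n²` whatever the sign
of `X_n`, so the all-negative separable solution is not reached from such data; recorded, not
proved here.  What IS checkable at time `0`: BFM Cor. 12's solution is non-zero on every shell
`n ≥ n₀+1` already at `t = 0` (arXiv:0811.1689 p. 9 Cor. 12; p. 10: `a_{n+1} = 2^{-n} + a_{n-1}²/(2a_n) > 0`),
so it is not a one-shell datum (`CascadeODESolutionFrom.init_X`) and it violates the a-priori decay
(4.5) (`|X_n(0)| ≍ Λ^{-n/3}` against the weight `1 + (1+ε₀)^{10n}`): the data class of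
`NoGlobalCascade` / `HasGlobal` / `ViscousGlobal` excludes it at time `0`, whatever the signs.)
[cite: Tao2016AveragedNS, §4 Lemma 4.1 (iii) (4.8) (the lattice law for general structure constants) written in self-similar variables `s = -log(t_* - t)`, `X_n = Λ^{-n} e^{s} Φ_{r(n)}(s - nT)`; cell vocabulary (the DSS ansatz and the admissibility clauses are the cell's, not Tao's)] -/
structure IsDSSWave (ε₀ : ℝ) (α : Fin m → Fin m → Fin m → ℤ × ℤ × ℤ → ℝ) (π : Equiv.Perm ρ)
    (T : ℝ) (Φ : ρ → ℝ → Em m) : Prop where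
  delay_pos : 0 < T
  wave : IsSWave π (tableQ α) (tableA α) (tableB α) 1 (bigLam ε₀) (bigLam ε₀)⁻¹ T Φ
  mass : Integrable (sMass Φ)
  bdd : ∃ x₀ P : ℝ, ∀ x, x₀ ≤ x → wEnergy 1 Φ x ≤ P

/-- The action exponent of a DSS wave of the table `α` (the constant in the residue bound `ẽ ≤ e^{H} · lim ẽ`):
`H = 2 C_A(α) (Λ e^{-2T} + Λ^{-1}) ∫ Σ_r ‖Φ_r‖`.
[cite: Tao2016AveragedNS, §4 (4.1), (4.8) (flux constant and gains); cell vocabulary] -/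
def dssAction (ε₀ : ℝ) (α : Fin m → Fin m → Fin m → ℤ × ℤ × ℤ → ℝ) (T : ℝ)
    (Φ : ρ → ℝ → Em m) : ℝ :=
  2 * fluxConst α * (|bigLam ε₀| * Real.exp (-(2 * 1 * T)) + |(bigLam ε₀)⁻¹|) * ∫ σ, sMass Φ σ

/-- **(S)-survival with exponent `a`** of a DSS wave at scale ratio `1+ε₀` with delay `T`: the
per-shell energy ratio satisfies `λ^{-a} ≤ μ < 1` (the heuristic "survives NS-scaled dissipation iff
`s = λμ > 1`" is `a = 1`; `μ < 1`: a wave reachable from finite-energy one-shell data is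
sub-unitary — each passed shell keeps `μ^n · lim ẽ`).
[cite: Tao2016AveragedNS, §4 (the viscous equation before Thm. 4.2: dissipation `(1+ε₀)^{2n} X_{i,n}` against gain `(1+ε₀)^{5n/2}`); cell vocabulary (the survival window `λ^{-a} ≤ μ < 1` is the cell's)] -/
def Surviving (a ε₀ T : ℝ) : Prop := (1 + ε₀) ^ (-a) ≤ dssMu ε₀ T ∧ dssMu ε₀ T < 1

end DSSWaves

section Eternal

variable {ρ : Type*} [Fintype ρ]
variable {m : ℕ}

/-- The shell vector `(X_{j,k}(t))_{j} ∈ ℝ^m` of a mode family `X` at shell `k`, time `t`.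
[cite: Tao2016AveragedNS, §4 Lemma 4.1 (the amplitudes `X_{i,n}(t)`); cell vocabulary] -/
def shellVec (X : Fin m → ℤ → ℝ → ℝ) (k : ℤ) (t : ℝ) : Em m := WithLp.toLp 2 fun j => X j k t

/-- **Admissible eternal solution** of the renormalised lattice of the table `α` at scale ratio
`1+ε₀`: the lattice law for every shell `n ∈ ℤ` and every log-time `σ ∈ ℝ` (damping `1`, feed
`Λ`, drain `Λ⁻¹`, exactly the profile system of `IsDSSWave` written shell-wise), a UNIFORM bound
on the per-shell action `∫‖W_n‖`, and per-shell boundedness of the renormalised energy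
`e^{2σ}‖W_n(σ)‖²` on a right half-line (the admissibility of `IsDSSWave`, shell-wise).
PLACEMENT: the separable blow-up `X_n = a_n/(t - t₀)` of the scalar chain (arXiv:0811.1689 p. 3;
see `IsDSSWave`) is `σ`-constant shell-wise, `W_n(σ) = Λ^n a_n ≠ 0`, so it violates the action
bound (`∫_ℝ ‖W_n‖ = ∞`) and the forward energy bound — it is not an admissible eternal solution;
these two clauses are load-bearing for every statement quantifying over `IsEternal`.
[cite: Tao2016AveragedNS, §4 Lemma 4.1 (iii) (4.8) written shell-wise in self-similar variables (damping `1`, feed `Λ`, drain `Λ⁻¹`); cell vocabulary (admissibility clauses are the cell's)] -/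
structure IsEternal (ε₀ : ℝ) (α : Fin m → Fin m → Fin m → ℤ × ℤ × ℤ → ℝ)
    (W : ℤ → ℝ → Em m) : Prop where
  law : ∀ (n : ℤ) (σ : ℝ), HasDerivAt (W n)
    (-((1 : ℝ) • W n σ) + tableQ α (W n σ) + bigLam ε₀ • tableA α (W (n - 1) σ)
      + (bigLam ε₀)⁻¹ • tableB α (W (n + 1) σ) (W n σ)) σ
  action : ∃ M : ℝ, ∀ n : ℤ, Integrable (fun σ => ‖W n σ‖) ∧ ∫ σ, ‖W n σ‖ ≤ M
  bdd : ∀ n : ℤ, ∃ σ₀ P : ℝ, ∀ σ, σ₀ ≤ σ → Real.exp (2 * σ) * ‖W n σ‖ ^ 2 ≤ P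

/-- The physical weight per shell: `(1+ε₀)^a · Λ^{-2} = (1+ε₀)^a/(1+ε₀)^5`.
[cite: Tao2016AveragedNS, §4 (4.1) (scale weights) ; cell vocabulary] -/
def physWeight (a ε₀ : ℝ) : ℝ := (1 + ε₀) ^ a / (1 + ε₀) ^ 5

/-- The eternal solution carried by a DSS wave: shell `n` holds profile `π^n r₀` delayed by `nT`.
[cite: Tao2016AveragedNS, §4 Lemma 4.1 (4.8); cell vocabulary (DSS profile family ↦ shell-wise solution)] -/
def dssEmbed (π : Equiv.Perm ρ) (T : ℝ) (Φ : ρ → ℝ → Em m) (r₀ : ρ) : ℤ → ℝ → Em m :=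
  fun n σ => Φ ((π ^ n) r₀) (σ - n * T)

omit [Fintype ρ] in
/-- Physical shell energy `‖X_n(t)‖² = Λ^{-2n} e^{2σ}‖W_n(σ)‖²`.
[cite: Tao2016AveragedNS, §4 Lemma 4.1 (4.10) (`E_{i,n} ≈ ½ X_{i,n}²`) in self-similar variables; cell vocabulary] -/
def physEnergy (ε₀ : ℝ) (W : ℤ → ℝ → Em m) (n : ℤ) (σ : ℝ) : ℝ :=
  (bigLam ε₀ ^ n)⁻¹ ^ 2 * (Real.exp (2 * σ) * ‖W n σ‖ ^ 2)

/-- Physical energy flux `n → n+1`: `F_n = 2Λ^{-2n-1} e^{2σ} ⟪W_{n+1}, A(W_n)⟫`.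
[cite: Tao2016AveragedNS, §1.2 (energy transfer at rate `λ^n X_{n+1} X_n²`) and §4 Lemma 4.1 (4.9); cell vocabulary] -/
def physFlux (ε₀ : ℝ) (α : Fin m → Fin m → Fin m → ℤ × ℤ × ℤ → ℝ) (W : ℤ → ℝ → Em m) (n : ℤ)
    (σ : ℝ) : ℝ :=
  2 * ((bigLam ε₀ ^ n)⁻¹ ^ 2 * (bigLam ε₀)⁻¹)
    * (Real.exp (2 * σ) * ⟪W (n + 1) σ, tableA α (W n σ)⟫)

/-- **Forward (S_a)-survival of an eternal solution**, junk-free: some level `c > 0` of the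
physical `a`-weighted shell energy `physWeight^n · e^{2σ}‖W_n(σ)‖²` is reached in arbitrarily
high shells `n ≥ N` at arbitrarily late log-times `σ ≥ N`.
[cite: Tao2016AveragedNS, §4 (the viscous equation before Thm. 4.2) ; cell vocabulary (survival of the `a`-weighted shell energy is the cell's predicate)] -/
def EternalSurvivingFwd (a ε₀ : ℝ) (W : ℤ → ℝ → Em m) : Prop :=
  ∃ c : ℝ, 0 < c ∧ ∀ N : ℕ, ∃ n : ℕ, N ≤ n ∧ ∃ σ : ℝ, (N : ℝ) ≤ σ ∧
    c ≤ physWeight a ε₀ ^ n * (Real.exp (2 * σ) * ‖W n σ‖ ^ 2)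

end Eternal

section Viscous

variable {m : ℕ}

/-- Global pseudo-solutions exist from `X₀` at shell `n₀` with defect constants `(K₁, K₂)`.
[cite: Tao2016AveragedNS, §4 Lemma 4.1 (4.5)–(4.11) and Thm. 4.2 (existence of global functions obeying the conclusions of Lemma 4.1; tree: `CascadeODESolutionFrom`)] -/
def HasGlobal (ε₀ : ℝ) (α : Fin m → Fin m → Fin m → ℤ × ℤ × ℤ → ℝ) (K₁ K₂ : ℝ) (n₀ : ℤ)
    (X₀ : Fin m → ℝ) : Prop :=
  ∃ X E : Fin m → ℤ → ℝ → ℝ, CascadeODESolutionFrom ε₀ α K₁ K₂ n₀ X₀ X E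

/-- The shell shift by `d` with the covariant clock: `(𝒮_d X)_{i,n}(t) = X_{i,n+d}(λ^{-5d/2} t)`.
[cite: Tao2016AveragedNS, §3, remark after Def. 3.1 («the exponent 5/2 … ensures … a dyadic version of the scale invariance») and §4 (4.1); cell vocabulary] -/
def shellShift (ε₀ : ℝ) (d : ℤ) (X : Fin m → ℤ → ℝ → ℝ) : Fin m → ℤ → ℝ → ℝ :=
  fun i n t => X i (n + d) ((1 + ε₀) ^ (-(5 : ℝ) / 2 * d) * t)

/-- A GLOBAL REGULAR solution of the NS-scaled viscous lattice with viscosity `ν` from the one-shell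
datum `X₀` at shell `0` (regular = the a-priori decay (4.5) on every `[0,T]`; motion within `[0,∞)`).
[cite: Tao2016AveragedNS, §4, the «viscous equation» displayed before Thm. 4.2 (`∂_t X_{i,n} = -(1+ε₀)^{2n} X_{i,n} + Σ α (1+ε₀)^{5(n-μ₃)/2} X X`), with a viscosity `ν` as in the footnote to (4.4), and Lemma 4.1 (4.5), (4.7), (4.11); cell vocabulary (exact motion, no defect terms)] -/
structure ViscousGlobal (ε₀ ν : ℝ) (α : Fin m → Fin m → Fin m → ℤ × ℤ × ℤ → ℝ) (X₀ : Fin m → ℝ)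
    (X : Fin m → ℤ → ℝ → ℝ) : Prop where
  contDiffOn : ∀ i n, ContDiffOn ℝ 1 (X i n) (Ici 0)
  apriori : ∀ T : ℝ, 0 < T → ∃ M : ℝ, ∀ t ∈ Icc 0 T, ∀ (i : Fin m) (n : ℤ),
    (1 + (1 + ε₀) ^ ((10 : ℝ) * n)) * |X i n t| ≤ M
  init : ∀ i n, X i n 0 = if n = 0 then X₀ i else 0
  motion : ∀ i n t, 0 ≤ t →
    derivWithin (X i n) (Ici 0) t =
      quadTerm ε₀ α X i n t - ν * (1 + ε₀) ^ ((2 : ℝ) * n) * X i n t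
  noLow : ∀ i n t, n < 0 → 0 ≤ t → X i n t = 0

/-- The dyadic (KP) table embedded in `Table 4` on component `0`.
[cite: Tao2016AveragedNS, §1.2 (the dyadic Katz–Pavlović system `∂_t X_n = -λ^{2nα} X_n + λ^{n-1} X_{n-1}² - λ^n X_n X_{n+1}`) and §4, remark before Thm. 4.2 («the viscous equation generalises the dyadic Katz–Pavlovic equation … m = 1»); cell vocabulary (embedded on component `0` of an `m = 4` table)] -/
def dyadicTable : (Fin 4 → Fin 4 → Fin 4 → ℤ × ℤ × ℤ → ℝ) := fun i₁ i₂ i₃ μ =>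
  if i₁ = 0 ∧ i₂ = 0 ∧ i₃ = 0 then
    (if μ = ((0 : ℤ), (0 : ℤ), (1 : ℤ)) then 1
      else if μ = ((1 : ℤ), (0 : ℤ), (0 : ℤ)) ∨ μ = ((0 : ℤ), (1 : ℤ), (0 : ℤ)) then -(1 / 2) else 0)
  else 0

end Viscous

section API

/-- `Λ = (1+ε₀)^{5/2} > 0` as soon as `1 + ε₀ > 0`. [cite: Tao2016AveragedNS, §4 (4.1) (the weight `(1+ε₀)^{5n/2}`, `ε₀ > 0`)] -/
theorem bigLam_pos {ε₀ : ℝ} (h : -1 < ε₀) : 0 < bigLam ε₀ :=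
  Real.rpow_pos_of_pos (by linarith) _

/-- The per-shell energy ratio `μ = e^{2T}/(1+ε₀)^5` is positive as soon as `1 + ε₀ > 0`.
[cite: Tao2016AveragedNS, §4 (4.1); cell vocabulary] -/
theorem dssMu_pos {ε₀ : ℝ} (T : ℝ) (h : -1 < ε₀) : 0 < dssMu ε₀ T :=
  div_pos (Real.exp_pos _) (pow_pos (by linarith) _)

/-- Components of the shell vector: `(shellVec X k t) j = X j k t`.
[cite: Tao2016AveragedNS, §4 Lemma 4.1 (the amplitudes `X_{i,n}(t)`); cell vocabulary] -/
@[simp] theorem shellVec_apply {m : ℕ} (X : Fin m → ℤ → ℝ → ℝ) (k : ℤ) (t : ℝ) (j : Fin m) :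
    shellVec X k t j = X j k t := rfl

end API

end Literature.Analysis.FluidPDE.TaoCascade

end
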